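import Summits.QuantumFields.YangMills.Theorems.BalabanUVNodesK0AxComplexGaussianRatioRecord

/-!
# K0 axis — the complex Gaussian ratio: the HILBERT–SCHMIDT BUDGET and the Gaussian tail FROM COERCIVITY ((F-im) in ENTRY currency)

LANDING NOTE (porter ▶ PTC-1 g4, 2026-08-31; AUTHORSHIP = ◇ lens-1 g13 «cauchy-analytic», HOME file `nodeO-cover/LENS-1g13-ComplexGaussianRatioBudget-v1.lean` sha16 0e537bb717064fb1 · 296 l. · 16
thm · 0 def (CANDIDATE 6 = CGRS FILE №6: (F-im) and the Gaussian tail WITHOUT the matrix inverse — §18 real matrices by Cauchy–Schwarz only (coercive `a·Σy² ≤ yᵀSy` ⇒ `det S ≠ 0`, `|S⁻¹x|² ≤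
|x|²∕a²`, `tr(S⁻¹BS⁻¹B) ≤ ‖B‖_F²∕a²` for ARBITRARY `B`, `0 < (S⁻¹)_{ii} ≤ 1∕a`, the tail sum `≤ |ι|·e^{−ar²∕2}`); §19 complex `M` under `a·Σx² ≤ Re quadC M x` (trace budget `≤ ‖Im M‖_F²∕a²`,
`‖R−1‖ ≤ e^{‖Im M‖_F²∕(4a²)}(η₁ + 2|ι|e^{−ar²∕2})`); §20 AT THE RECORD: `bddOnPoly_recordFluctRatioC_of_sum_sq_im`, `norm_recordFluctRatioC_sub_one_le_of_sum_sq_im`,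
★★★`norm_decDiffList_recordFluctRatioC_le_of_sum_sq_im` — the end-to-end (1.18)-shaped rate whose displayed hypotheses are exactly (F-coer) · (F-int) · (F-im-e) `Σ_{ij}(Im (piecesFormC …)_{ij})² ≤
a²τ`, no inverse, no trace, no PosDef letter in the interface): landed under ◇'s basename `…Theorems/BalabanUVNodesK0AxComplexGaussianRatioBudget.lean` (ns `…Theorems.K0AxComplexGaussianRatio`) as
INTENT-85; `--supports stmt-QuantumFields-27930 --as helper --cite Balaban1987RG1 --cite Balaban1988RG2Cluster --cite Brydges1986` (NO `--workitem`; kind auto ⇒ proof). BYTES: ◇'s own path-(α)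
edition `nodeO-cover/LENS-1g13-ComplexGaussianRatioBudget-v1a.lean` sha16 949cfeaf1fd88acf VERBATIM (= v1 0e537bb717064fb1 with line 1 `import …K0AxComplexGaussianRatioRecord` instead of `…Rate` —
◇'s file №5 `…Rate` was NOT landed because its 5 theorems are §16–§17 of the landed №4 v2 ✓p827778 (◆ CRIT-1 g39 15:46:29Z «path (α)∕(β) indifferent — same 12 declarations») — and header l.7
reworded accordingly; theorem bytes identical) plus this paragraph. ◆ CRIT-1's cut: ◆ CRIT-1 g39 «(A) CUT ◇ №6 `…K0AxComplexGaussianRatioBudget` — SAME-WALL: removes the matrix inverse from (F-im)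
and from the Gaussian tail by coercivity + Cauchy–Schwarz only — a CURRENCY CHANGE at the known (F-im)∕tail wall, not a restatement ⇒ SURVIVES, priced «finite-dimensional bookkeeping on DEF-1's
vocabulary; (F-coer)(F-int)(F-im-e) displayed, inhabited NOWHERE»; located-A = ✓p827778 `…Record` (consumed BY NAME in §19–§20) ∧ located-B = the model hands' (E3)∕(P5ᶜ) entry currency; J1′: the
only junk-capable symbol is `Matrix.inv`, every use under `IsUnit S.det` derived in-file from coercivity (`det_ne_zero_of_quadFormR_coercive`) — no `0⁻¹` reading; §20 hypotheses jointly
satisfiable — non-vacuous; J4 BY NAME 0∕16 (controls `gaussSymmPart` 63, `recordFluctRatioC` 26); J4 BY STATEMENT: cousins only (QCD `StubDetPerturbIR.det_ne_zero_of_coercive` complex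
norm-coercive, RH `IntegerScrewResolventVariational.inv_apply_self_pos` PosDef) — no twin, no rider; J5′ n∕a; customs-before-landing: v1a ≡ staged on declarations (declcmp 16 SAME · 0 DIFF); probe
`scratch/Crit1Cut6_Budget_verbatim.lean` 0a097eff65363980 = v1a ⊕ 16 std guards ⇒ farm rc 0 · 0 warn · 0 sorry, 16∕16 {propext, Classical.choice, Quot.sound} ⇒ №6: GO VERBATIM (v1a 949cfeaf
theorem bytes; `--supports stmt-QuantumFields-27930 --as helper --cite Balaban1987RG1 --cite Balaban1988RG2Cluster --cite Brydges1986`, kind proof)» (nodeO STATUS 2026-08-31T16:05:13Z). HONEST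
(porter): Mathlib linear algebra ∕ analysis (Cauchy–Schwarz, Frobenius norms) on DEF-1's typed vocabulary; the MODEL faces (F-coer)∕(F-int)∕(F-im-e) are displayed hypotheses inhabited NOWHERE; the
bridge to print's (2.12)–(2.13) is ◆ (R-b) stage 2; nothing of Bałaban asserted, ported, discharged or refuted; `stub_FE`∕`stub_P0C` and ⟨27930⟩ OPEN; K0⁷ 20541 ∕ K0ᴬ 27238 ∕ K1ᴬ ∕ K3ᴬ OPEN —
NOTHING of them proved; NODE O 0∕1; COUNT 8∕28 · K 1∕4 UNMOVED; finite 𝕋⁴ at fixed ε — NOT continuum ∕ OS ∕ Clay; the Yang–Mills mass gap is NOT proved by any of this.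

LENS-1 (ideator 1, g13) companion file №6 (`Summits/QuantumFields/YangMills/Theorems/BalabanUVNodesK0AxComplexGaussianRatioBudget.lean`, namespace `…Theorems.K0AxComplexGaussianRatio`),
importing file №4 `…Record` (✓p827778; path α — file №5 `…Rate` is subsumed by it).  PURPOSE.  After files №1–№4 the N4-R leaves are the three MODEL faces (F-coer), (F-int), (F-im), where
(F-im) was still phrased as the Hilbert–Schmidt trace `tr(S⁻¹ B S⁻¹ B) ≤ τ` (`S = Re ½(M+Mᵀ)`, `B = Im ½(M+Mᵀ)`) and the `|R − 1|` tail as `Σ_i e^{−r²∕(2(S⁻¹)_{ii})}` — both in INVERSE-MATRIX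
currency, which is not how the model hands ((E3)∕(P5ᶜ): entrywise ∕ row-sum smallness of the complex part of the pieces form) will read them.  This file removes the inverse from both:

* §18 (real matrices, NO spectral theory — Cauchy–Schwarz only): from COERCIVITY `a·Σy² ≤ yᵀSy` (`S` not even assumed symmetric): `det S ≠ 0` (`det_ne_zero_of_quadFormR_coercive`), `|S⁻¹x|² ≤ |x|²∕a²`
  (`sum_sq_inv_mulVec_le_of_coercive`), `tr(Y²) ≤ ‖Y‖_F²` (`trace_mul_self_le_sum_sq`), ★★ **`tr(S⁻¹BS⁻¹B) ≤ ‖B‖_F²∕a²`** (`trace_inv_mul_inv_mul_le_of_coercive`, `B` arbitrary), the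
  diagonal of the inverse `0 < (S⁻¹)_{ii} ≤ 1∕a` (`inv_apply_self_pos_of_coercive`, `inv_apply_self_le_of_coercive`) and the tail sum `Σ_i e^{−r²∕(2(S⁻¹)_{ii})} ≤ |ι|·e^{−a r²∕2}`
  (`sum_exp_tail_le_of_coercive`);
* §19 (complex `M` with `a·Σx² ≤ Re quadC M x`): coercivity transported to `Re ½(M+Mᵀ)` (`coercive_map_re_gaussSymmPart`), `‖Im ½(M+Mᵀ)‖_F ≤ ‖Im M‖_F` (`sum_sq_map_im_gaussSymmPart_le`),
  ★★ **the trace budget `≤ ‖Im M‖_F²∕a²`** (`trace_budget_le_sum_sq_im_of_coercive`), the tail `≤ |ι|·e^{−a r²∕2}` and ★★ `‖R − 1‖ ≤ e^{‖Im M‖_F²∕(4a²)}·(η₁ + 2|ι|e^{−a r²∕2})`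
  (`norm_gaussRatioC_sub_one_le_of_coercive`);
* §20 AT THE RECORD (DEF-1's ✓`recordFluctRatioC`∕`piecesFormC`∕`chiRem`): `bddOnPoly_recordFluctRatioC_of_sum_sq_im`, ★★ `norm_recordFluctRatioC_sub_one_le_of_sum_sq_im`,
  ★★★ `norm_decDiffList_recordFluctRatioC_le_of_sum_sq_im` — the END-TO-END (1.18)-shaped rate with (F-im) now read **`Σ_{ij} (Im (piecesFormC … s ψ)_{ij})² ≤ a²·τ` on `cpoly(1+e^{κ₁})`**
  and NO matrix inverse anywhere in the displayed hypotheses.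
NUMBERS (NODE v18): with `a = γ₀∕2` the (F-im) face becomes `‖Im 𝐌(s)‖_F ≤ (γ₀∕2)·√τ`; the tail term is `2·|ι|·e^{−γ₀ r²∕4}` with `|ι| ≤ 3·#bonds` — i.e. the v17.1 budget
`ε₁² > (12∕γ₀)(log(8|ι|) + …)` is now a THEOREM-shaped line, not a reading.
HONEST: finite-dimensional linear algebra ∕ calculus about DEF-1's VOCABULARY; (F-coer)(F-int)(F-im) are NOT inhabited here (they are the model hands' (E3)∕(P5ᶜ) letters); the bridge of
`recordFluctRatioC` to print's (2.12)–(2.13) is ◆ (R-b), stage 2; `stub_FE`∕`stub_P0C`∕⟨27930⟩∕K0⁷∕K0ᴬ OPEN; NODE O 0∕1; finite 𝕋⁴ at fixed ε — NOT continuum∕OS; **the Yang–Mills mass gap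
(Clay) is NOT proved here.**  No `sorry`; no new `Prop` letters; no instances∕notation∕attributes.
-/

noncomputable section

open scoped BigOperators Topology
open MeasureTheory Complex Metric Set Function
open Summit.QuantumFields.YangMills.Theorems.K0RecordFormatNames
open Summit.QuantumFields.YangMills.Theorems.K0AxCauchyDecoupling (cpoly SepHolOff BddOnPoly decDiffList norm_decDiffList_le_exp_of_le_length)
open Literature.MathematicalPhysics.QuantumFieldTheory.Balaban1983to89.T4Continuum (T4Family)

namespace Summit.QuantumFields.YangMills.Theorems.K0AxComplexGaussianRatio

/-! ## §18  The Hilbert–Schmidt budget and the inverse diagonal FROM COERCIVITY (real matrices; Cauchy–Schwarz only) -/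

section HSBudget

variable {ι : Type*} [Fintype ι]

open Matrix

/-- Coercive ⇒ nonsingular. [cite: Balaban1988RG2Cluster, (1.9)–(1.10) p.4 (bookkeeping)] -/
theorem det_ne_zero_of_quadFormR_coercive [DecidableEq ι] (S : Matrix ι ι ℝ) {a : ℝ} (ha : 0 < a)
    (hS : ∀ y : ι → ℝ, a * ∑ i, y i ^ 2 ≤ quadFormR S y) : S.det ≠ 0 := by
  intro hdet
  obtain ⟨v, hv, hSv⟩ := Matrix.exists_mulVec_eq_zero_iff.mpr hdet
  have h1 : a * ∑ i, v i ^ 2 ≤ 0 := by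
    have h := hS v
    rwa [quadFormR_eq_dotProduct, hSv, dotProduct_zero] at h
  have h0 : 0 ≤ ∑ i, v i ^ 2 := Finset.sum_nonneg fun j _ => sq_nonneg (v j)
  have h2 : ∑ i, v i ^ 2 = 0 := by nlinarith
  have h3 : ∀ i, v i = 0 := fun i => by
    have h := (Finset.sum_eq_zero_iff_of_nonneg fun j _ => sq_nonneg (v j)).mp h2 i (Finset.mem_univ i)
    exact pow_eq_zero_iff (two_ne_zero) |>.mp h
  exact hv (funext h3)

/-- `|S⁻¹ x|² ≤ |x|²∕a²` from coercivity (via `a|y|² ≤ yᵀSy = y·x ≤ |y||x|`). [cite: Balaban1988RG2Cluster, (1.9)–(1.10) p.4 (bookkeeping)] -/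
theorem sum_sq_inv_mulVec_le_of_coercive [DecidableEq ι] (S : Matrix ι ι ℝ) {a : ℝ} (ha : 0 < a)
    (hS : ∀ y : ι → ℝ, a * ∑ i, y i ^ 2 ≤ quadFormR S y) (x : ι → ℝ) :
    ∑ i, (S⁻¹ *ᵥ x) i ^ 2 ≤ (∑ i, x i ^ 2) / a ^ 2 := by
  set y := S⁻¹ *ᵥ x with hy
  have hdet : IsUnit S.det := isUnit_iff_ne_zero.mpr (det_ne_zero_of_quadFormR_coercive S ha hS)
  have hSy : S *ᵥ y = x := by rw [hy, Matrix.mulVec_mulVec, Matrix.mul_nonsing_inv _ hdet, Matrix.one_mulVec]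
  have h1 : a * ∑ i, y i ^ 2 ≤ ∑ i, y i * x i := by
    have h := hS y
    rw [quadFormR_eq_dotProduct, hSy] at h
    simpa [dotProduct] using h
  have h2 : (∑ i, y i * x i) ^ 2 ≤ (∑ i, y i ^ 2) * ∑ i, x i ^ 2 := Finset.sum_mul_sq_le_sq_mul_sq _ _ _
  have hy0 : 0 ≤ ∑ i, y i ^ 2 := Finset.sum_nonneg fun i _ => sq_nonneg _
  have hx0 : 0 ≤ ∑ i, x i ^ 2 := Finset.sum_nonneg fun i _ => sq_nonneg _
  have h3 : (a * ∑ i, y i ^ 2) ^ 2 ≤ (∑ i, y i ^ 2) * ∑ i, x i ^ 2 := (pow_le_pow_left₀ (by positivity) h1 2).trans h2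
  rw [le_div_iff₀ (by positivity)]
  by_cases hz : ∑ i, y i ^ 2 = 0
  · rw [hz, zero_mul]; exact hx0
  · have hpos : 0 < ∑ i, y i ^ 2 := lt_of_le_of_ne hy0 (Ne.symm hz)
    have h4 : ((∑ i, y i ^ 2) * a ^ 2) * ∑ i, y i ^ 2 ≤ (∑ i, x i ^ 2) * ∑ i, y i ^ 2 := by nlinarith [h3]
    exact le_of_mul_le_mul_right h4 hpos

omit [Fintype ι] in
/-- `tr(Y²) ≤ ‖Y‖_F²` (from `0 ≤ Σ (Y_ij − Y_ji)²`). [cite: Balaban1988RG2Cluster, (1.9)–(1.10) p.4 (bookkeeping)] -/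
theorem trace_mul_self_le_sum_sq [Fintype ι] (Y : Matrix ι ι ℝ) : (Y * Y).trace ≤ ∑ i, ∑ j, Y i j ^ 2 := by
  have hc : ∑ i, ∑ j, Y j i ^ 2 = ∑ i, ∑ j, Y i j ^ 2 := Finset.sum_comm
  have h0 : 0 ≤ ∑ i, ∑ j, (Y i j - Y j i) ^ 2 := by positivity
  have hx : ∑ i, ∑ j, (Y i j - Y j i) ^ 2
      = (∑ i, ∑ j, Y i j ^ 2) - 2 * (∑ i, ∑ j, Y i j * Y j i) + ∑ i, ∑ j, Y j i ^ 2 := by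
    simp only [sub_sq, Finset.sum_add_distrib, Finset.sum_sub_distrib, Finset.mul_sum, mul_assoc]
  have htr : (Y * Y).trace = ∑ i, ∑ j, Y i j * Y j i := by simp [Matrix.trace, Matrix.mul_apply]
  rw [htr]; linarith [hc]

/-- ★★ **`tr(S⁻¹ B S⁻¹ B) ≤ ‖B‖_F²∕a²`** for `S` coercive with constant `a` and `B` ARBITRARY. [cite: Balaban1988RG2Cluster, (1.9)–(1.10) p.4 (generic form of the (F-im) budget)] -/
theorem trace_inv_mul_inv_mul_le_of_coercive [DecidableEq ι] (S B : Matrix ι ι ℝ) {a : ℝ} (ha : 0 < a)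
    (hS : ∀ y : ι → ℝ, a * ∑ i, y i ^ 2 ≤ quadFormR S y) :
    (S⁻¹ * B * S⁻¹ * B).trace ≤ (∑ i, ∑ j, B i j ^ 2) / a ^ 2 := by
  rw [Matrix.mul_assoc (S⁻¹ * B) S⁻¹ B]
  refine (trace_mul_self_le_sum_sq _).trans ?_
  have hcol : ∀ j, ∑ i, (S⁻¹ * B) i j ^ 2 ≤ (∑ i, B i j ^ 2) / a ^ 2 := fun j => by
    have h := sum_sq_inv_mulVec_le_of_coercive S ha hS (fun i => B i j)
    simpa [Matrix.mulVec, dotProduct, Matrix.mul_apply] using h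
  calc ∑ i, ∑ j, (S⁻¹ * B) i j ^ 2 = ∑ j, ∑ i, (S⁻¹ * B) i j ^ 2 := Finset.sum_comm
    _ ≤ ∑ j, (∑ i, B i j ^ 2) / a ^ 2 := Finset.sum_le_sum fun j _ => hcol j
    _ = (∑ i, ∑ j, B i j ^ 2) / a ^ 2 := by rw [← Finset.sum_div, Finset.sum_comm]

/-- `0 < (S⁻¹)_{ii}` for coercive `S`. [cite: Balaban1987RG1, (2.19) p.270 (bookkeeping)] -/
theorem inv_apply_self_pos_of_coercive [DecidableEq ι] (S : Matrix ι ι ℝ) {a : ℝ} (ha : 0 < a)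
    (hS : ∀ y : ι → ℝ, a * ∑ i, y i ^ 2 ≤ quadFormR S y) (i : ι) : 0 < S⁻¹ i i := by
  set y := S⁻¹ *ᵥ Pi.single i 1 with hy
  have hdet : IsUnit S.det := isUnit_iff_ne_zero.mpr (det_ne_zero_of_quadFormR_coercive S ha hS)
  have hSy : S *ᵥ y = Pi.single i 1 := by rw [hy, Matrix.mulVec_mulVec, Matrix.mul_nonsing_inv _ hdet, Matrix.one_mulVec]
  have hyi : y i = S⁻¹ i i := by simp [hy]
  have hy0 : y ≠ 0 := fun h => by
    have h' : S *ᵥ y = 0 := by rw [h, Matrix.mulVec_zero]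
    rw [hSy] at h'
    have := congr_fun h' i
    simp at this
  have hq : quadFormR S y = y i := by
    rw [quadFormR_eq_dotProduct, hSy]; simp [dotProduct, Pi.single_apply]
  have hpos : 0 < ∑ k, y k ^ 2 := by
    obtain ⟨k, hk⟩ := Function.ne_iff.mp hy0
    exact lt_of_lt_of_le (lt_of_le_of_ne (sq_nonneg _) (Ne.symm (pow_ne_zero 2 hk)))
      (Finset.single_le_sum (fun j _ => sq_nonneg (y j)) (Finset.mem_univ k))
  have h := hS y
  rw [hq] at h
  rw [← hyi]; nlinarith

/-- `(S⁻¹)_{ii} ≤ 1∕a` for coercive `S`. [cite: Balaban1987RG1, (2.19) p.270 (bookkeeping)] -/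
theorem inv_apply_self_le_of_coercive [DecidableEq ι] (S : Matrix ι ι ℝ) {a : ℝ} (ha : 0 < a)
    (hS : ∀ y : ι → ℝ, a * ∑ i, y i ^ 2 ≤ quadFormR S y) (i : ι) : S⁻¹ i i ≤ 1 / a := by
  have h := sum_sq_inv_mulVec_le_of_coercive S ha hS (Pi.single i 1)
  have hyi : (S⁻¹ *ᵥ Pi.single i 1) i = S⁻¹ i i := by simp [Matrix.mulVec, dotProduct, Pi.single_apply]
  have h1 : ∑ k, (Pi.single i (1 : ℝ) : ι → ℝ) k ^ 2 = 1 := by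
    rw [Finset.sum_eq_single i (fun k _ hk => by simp [hk]) (fun h => (h (Finset.mem_univ i)).elim)]
    simp
  rw [h1] at h
  have h2 : S⁻¹ i i ^ 2 ≤ (1 / a) ^ 2 := by
    rw [← hyi, div_pow, one_pow]
    exact (Finset.single_le_sum (fun k _ => sq_nonneg ((S⁻¹ *ᵥ Pi.single i 1) k)) (Finset.mem_univ i)).trans h
  have h3 : |S⁻¹ i i| ≤ |1 / a| := sq_le_sq.mp h2
  rw [abs_of_pos (by positivity : (0 : ℝ) < 1 / a)] at h3
  exact (le_abs_self _).trans h3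

/-- The Gaussian tail sum in coercive currency: `Σ_i e^{−r²∕(2(S⁻¹)_{ii})} ≤ |ι|·e^{−a r²∕2}`. [cite: Balaban1987RG1, (2.19) p.270 (bookkeeping)] -/
theorem sum_exp_tail_le_of_coercive [DecidableEq ι] (S : Matrix ι ι ℝ) {a : ℝ} (ha : 0 < a)
    (hS : ∀ y : ι → ℝ, a * ∑ i, y i ^ 2 ≤ quadFormR S y) (r : ℝ) :
    ∑ i, Real.exp (-(r ^ 2 / (2 * S⁻¹ i i))) ≤ Fintype.card ι * Real.exp (-(a * r ^ 2 / 2)) := by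
  have h : ∀ i, Real.exp (-(r ^ 2 / (2 * S⁻¹ i i))) ≤ Real.exp (-(a * r ^ 2 / 2)) := fun i => by
    have hv := inv_apply_self_pos_of_coercive S ha hS i
    have hv' := inv_apply_self_le_of_coercive S ha hS i
    have hav : a * S⁻¹ i i ≤ 1 := by
      have := mul_le_mul_of_nonneg_left hv' ha.le
      rwa [mul_one_div_cancel ha.ne'] at this
    apply Real.exp_le_exp.mpr
    have : a * r ^ 2 / 2 ≤ r ^ 2 / (2 * S⁻¹ i i) := by
      rw [le_div_iff₀ (by positivity)]
      nlinarith [sq_nonneg r, hv]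
    linarith
  calc ∑ i, Real.exp (-(r ^ 2 / (2 * S⁻¹ i i))) ≤ ∑ _i : ι, Real.exp (-(a * r ^ 2 / 2)) := Finset.sum_le_sum fun i _ => h i
    _ = Fintype.card ι * Real.exp (-(a * r ^ 2 / 2)) := by simp

end HSBudget

/-! ## §19  The complex form: (F-im) and the tail in ENTRY ∕ COERCIVE currency -/

section HSBudgetC

variable {ι : Type*} [Fintype ι]

open Matrix

/-- Coercivity of `Re quadC M` IS coercivity of the real form of `Re ½(M+Mᵀ)`. [cite: Balaban1988RG2Cluster, (1.9)–(1.10) p.4 (bookkeeping)] -/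
theorem coercive_map_re_gaussSymmPart (M : Matrix ι ι ℂ) {a : ℝ}
    (hcoer : ∀ x : ι → ℝ, a * ∑ i, x i ^ 2 ≤ (quadC M x).re) (y : ι → ℝ) :
    a * ∑ i, y i ^ 2 ≤ quadFormR ((gaussSymmPart M).map Complex.re) y := by
  rw [← re_quadC, quadC_gaussSymmPart]; exact hcoer y

omit [Fintype ι] in
/-- The entries of `Im ½(M+Mᵀ)`. [cite: Balaban1988RG2Cluster, (1.9)–(1.10) p.4 (bookkeeping)] -/
theorem map_im_gaussSymmPart_apply (M : Matrix ι ι ℂ) (i j : ι) :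
    ((gaussSymmPart M).map Complex.im) i j = ((M i j).im + (M j i).im) / 2 := by
  simp only [gaussSymmPart, Matrix.map_apply, Matrix.smul_apply, Matrix.add_apply, Matrix.transpose_apply, smul_eq_mul]
  rw [show (1 / 2 : ℂ) = ((1 / 2 : ℝ) : ℂ) by push_cast; ring, Complex.im_ofReal_mul, Complex.add_im]; ring

/-- `‖Im ½(M+Mᵀ)‖_F² ≤ ‖Im M‖_F²`. [cite: Balaban1988RG2Cluster, (1.9)–(1.10) p.4 (bookkeeping)] -/
theorem sum_sq_map_im_gaussSymmPart_le (M : Matrix ι ι ℂ) :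
    ∑ i, ∑ j, ((gaussSymmPart M).map Complex.im) i j ^ 2 ≤ ∑ i, ∑ j, (M i j).im ^ 2 := by
  have hc : ∑ i, ∑ j, (M j i).im ^ 2 = ∑ i, ∑ j, (M i j).im ^ 2 := Finset.sum_comm
  have hle : ∀ i j, ((gaussSymmPart M).map Complex.im) i j ^ 2 ≤ ((M i j).im ^ 2 + (M j i).im ^ 2) / 2 := fun i j => by
    rw [map_im_gaussSymmPart_apply]; nlinarith [sq_nonneg ((M i j).im - (M j i).im)]
  have hsum : ∑ i, ∑ j, ((M i j).im ^ 2 + (M j i).im ^ 2) / 2 = ((∑ i, ∑ j, (M i j).im ^ 2) + ∑ i, ∑ j, (M j i).im ^ 2) / 2 := by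
    rw [add_div, Finset.sum_div, Finset.sum_div, ← Finset.sum_add_distrib]
    refine Finset.sum_congr rfl fun i _ => ?_
    rw [Finset.sum_div, Finset.sum_div, ← Finset.sum_add_distrib]
    exact Finset.sum_congr rfl fun j _ => by ring
  calc ∑ i, ∑ j, ((gaussSymmPart M).map Complex.im) i j ^ 2 ≤ ∑ i, ∑ j, ((M i j).im ^ 2 + (M j i).im ^ 2) / 2 :=
        Finset.sum_le_sum fun i _ => Finset.sum_le_sum fun j _ => hle i j
    _ = ((∑ i, ∑ j, (M i j).im ^ 2) + ∑ i, ∑ j, (M j i).im ^ 2) / 2 := hsum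
    _ = ∑ i, ∑ j, (M i j).im ^ 2 := by rw [hc]; ring

/-- ★★ **(F-im) in ENTRY currency**: `tr(S⁻¹BS⁻¹B) ≤ ‖Im M‖_F²∕a²` (`S = Re ½(M+Mᵀ)`, `B = Im ½(M+Mᵀ)`) from `a·Σx² ≤ Re quadC M x`.
[cite: Balaban1988RG2Cluster, (1.9)–(1.10) p.4; Brydges1986, Part III §2 (locator)] -/
theorem trace_budget_le_sum_sq_im_of_coercive [DecidableEq ι] (M : Matrix ι ι ℂ) {a : ℝ} (ha : 0 < a)
    (hcoer : ∀ x : ι → ℝ, a * ∑ i, x i ^ 2 ≤ (quadC M x).re) :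
    (((gaussSymmPart M).map Complex.re)⁻¹ * (gaussSymmPart M).map Complex.im
        * ((gaussSymmPart M).map Complex.re)⁻¹ * (gaussSymmPart M).map Complex.im).trace
      ≤ (∑ i, ∑ j, (M i j).im ^ 2) / a ^ 2 :=
  (trace_inv_mul_inv_mul_le_of_coercive _ _ ha (coercive_map_re_gaussSymmPart M hcoer)).trans
    (div_le_div_of_nonneg_right (sum_sq_map_im_gaussSymmPart_le M) (by positivity))

/-- The tail sum at the complex form in coercive currency. [cite: Balaban1987RG1, (2.19) p.270 (bookkeeping)] -/
theorem sum_exp_tail_gaussSymmPart_le_of_coercive [DecidableEq ι] (M : Matrix ι ι ℂ) {a : ℝ} (ha : 0 < a)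
    (hcoer : ∀ x : ι → ℝ, a * ∑ i, x i ^ 2 ≤ (quadC M x).re) (r : ℝ) :
    ∑ i, Real.exp (-(r ^ 2 / (2 * ((gaussSymmPart M).map Complex.re)⁻¹ i i))) ≤ Fintype.card ι * Real.exp (-(a * r ^ 2 / 2)) :=
  sum_exp_tail_le_of_coercive _ ha (coercive_map_re_gaussSymmPart M hcoer) r

/-- ★★ **`‖R − 1‖ ≤ e^{‖Im M‖_F²∕(4a²)}·(η₁ + 2|ι|·e^{−a r²∕2})`** — the `|R − 1|` clause with NO matrix inverse: coercivity, measurability, `χ = 1` on the box, `‖e^E − 1‖ ≤ η₁` on `supp χ`.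
[cite: Balaban1987RG1, (2.12)+(2.19) p.268–270; Balaban1988RG2Cluster, (1.9)–(1.10) p.4] -/
theorem norm_gaussRatioC_sub_one_le_of_coercive [DecidableEq ι] (χ : (ι → ℝ) → ℝ) (hχm : Measurable χ) (hχ : ∀ x, 0 ≤ χ x ∧ χ x ≤ 1)
    (M : Matrix ι ι ℂ) {a : ℝ} (ha : 0 < a) (hcoer : ∀ x : ι → ℝ, a * ∑ i, x i ^ 2 ≤ (quadC M x).re)
    (E : (ι → ℝ) → ℂ) (hEm : Measurable E) {η₁ r : ℝ} (hη₁ : 0 ≤ η₁) (hr : 0 ≤ r)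
    (hχbox : ∀ x : ι → ℝ, (∀ i, |x i| ≤ r) → χ x = 1) (hE : ∀ x, χ x ≠ 0 → ‖cexp (E x) - 1‖ ≤ η₁) :
    ‖gaussRatioC χ M E - 1‖ ≤ Real.exp ((∑ i, ∑ j, (M i j).im ^ 2) / (4 * a ^ 2)) * (η₁ + 2 * (Fintype.card ι * Real.exp (-(a * r ^ 2 / 2)))) := by
  refine (norm_gaussRatioC_sub_one_le_box_of_coercive χ hχm hχ M ha hcoer E hEm hη₁ hr hχbox hE).trans ?_
  have h1 := trace_budget_le_sum_sq_im_of_coercive M ha hcoer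
  have h2 := sum_exp_tail_gaussSymmPart_le_of_coercive M ha hcoer r
  have hpos : 0 ≤ η₁ + 2 * ∑ i, Real.exp (-(r ^ 2 / (2 * ((gaussSymmPart M).map Complex.re)⁻¹ i i))) := by positivity
  refine mul_le_mul (Real.exp_le_exp.mpr ?_) (by linarith) hpos (Real.exp_pos _).le
  have : (∑ i, ∑ j, (M i j).im ^ 2) / (4 * a ^ 2) = (1 / 4 : ℝ) * ((∑ i, ∑ j, (M i j).im ^ 2) / a ^ 2) := by ring
  rw [this]
  exact mul_le_mul_of_nonneg_left h1 (by norm_num)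

end HSBudgetC

/-! ## §20  AT THE RECORD: (F-im) read as `Σ_{ij} (Im (piecesFormC … s ψ)_{ij})² ≤ a²·τ` — no inverse in any displayed hypothesis -/

variable (F : T4Family)

open Classical in
/-- Layer 2 with (F-im) in entry currency. [cite: Balaban1988RG2Cluster, (1.8)–(1.10) p.3–5, (1.16) p.6; Balaban1987RG1, (2.12)–(2.13) p.268] -/
theorem bddOnPoly_recordFluctRatioC_of_sum_sq_im {Ψ : Type*} (Mc k K : ℕ) (ε₁ : ℝ)
    (T : (recordDomSys F Mc k K).Dom → Ψ → FluctIdx F k K → FluctIdx F k K → ℂ) (E : ℝ → ((Fin 4 → ℤ) → ℂ) → Ψ → (NonB0Idx F k K → ℝ) → ℂ) (g : ℝ) (ψ : Ψ)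
    {R : ℝ} {a : ℝ} (ha : 0 < a) (η τ : ℝ)
    (hcoer : ∀ s ∈ cpoly (ι := Fin 4 → ℤ) R, ∀ x : NonB0Idx F k K → ℝ, a * ∑ i, x i ^ 2 ≤ (quadC (piecesFormC F k K T (recordSWeight F Mc k K s) ψ) x).re)
    (hEre : ∀ s ∈ cpoly (ι := Fin 4 → ℤ) R, ∀ x, chiRem F k K ε₁ x ≠ 0 → (E g s ψ x).re ≤ η)
    (him : ∀ s ∈ cpoly (ι := Fin 4 → ℤ) R, ∑ i, ∑ j, ((piecesFormC F k K T (recordSWeight F Mc k K s) ψ) i j).im ^ 2 ≤ a ^ 2 * τ) :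
    BddOnPoly R (Real.exp (η + (1 / 4 : ℝ) * τ)) (fun s => recordFluctRatioC F Mc k K ε₁ T E g s ψ) := by
  refine bddOnPoly_recordFluctRatioC F Mc k K ε₁ T E g ψ ha η τ hcoer hEre fun s hs => ?_
  refine (trace_budget_le_sum_sq_im_of_coercive _ ha (hcoer s hs)).trans ?_
  rw [div_le_iff₀ (by positivity)]
  linarith [him s hs]

open Classical in
/-- ★★ **the `|c| = 1` clause at the record, entry currency**: `‖recordFluctRatioC − 1‖ ≤ e^{θ∕(4a²)}·(η₁ + 2|ι|e^{−a r²∕2})` from (F-coer), (F-int) and `‖Im piecesFormC‖_F² ≤ θ`.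
[cite: Balaban1987RG1, (2.9) p.266, (2.12)+(2.19) p.268–270; Balaban1988RG2Cluster, (1.9)–(1.10) p.4] -/
theorem norm_recordFluctRatioC_sub_one_le_of_sum_sq_im {Ψ : Type*} (Mc k K : ℕ) (ε₁ : ℝ)
    (T : (recordDomSys F Mc k K).Dom → Ψ → FluctIdx F k K → FluctIdx F k K → ℂ) (E : ℝ → ((Fin 4 → ℤ) → ℂ) → Ψ → (NonB0Idx F k K → ℝ) → ℂ) (g : ℝ) (ψ : Ψ)
    (s : (Fin 4 → ℤ) → ℂ) {a : ℝ} (ha : 0 < a)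
    (hcoer : ∀ x : NonB0Idx F k K → ℝ, a * ∑ i, x i ^ 2 ≤ (quadC (piecesFormC F k K T (recordSWeight F Mc k K s) ψ) x).re)
    (hEm : Measurable (E g s ψ)) {η₁ r θ : ℝ} (hη₁ : 0 ≤ η₁) (hr : 0 ≤ r) (hrε : Real.sqrt 3 * r < ε₁)
    (hE : ∀ x, chiRem F k K ε₁ x ≠ 0 → ‖cexp (E g s ψ x) - 1‖ ≤ η₁)
    (him : ∑ i, ∑ j, ((piecesFormC F k K T (recordSWeight F Mc k K s) ψ) i j).im ^ 2 ≤ θ) :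
    ‖recordFluctRatioC F Mc k K ε₁ T E g s ψ - 1‖
      ≤ Real.exp (θ / (4 * a ^ 2)) * (η₁ + 2 * (Fintype.card (NonB0Idx F k K) * Real.exp (-(a * r ^ 2 / 2)))) := by
  rw [recordFluctRatioC_eq]
  refine (norm_gaussRatioC_sub_one_le_of_coercive (chiRem F k K ε₁) (measurable_chiRem F k K ε₁) (chiRem_nonneg_le_one F k K ε₁) _ ha hcoer
    _ hEm hη₁ hr (chiRem_eq_one_of_box F k K hr hrε) hE).trans ?_
  have hpos : 0 ≤ η₁ + 2 * (Fintype.card (NonB0Idx F k K) * Real.exp (-(a * r ^ 2 / 2))) := by positivity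
  exact mul_le_mul_of_nonneg_right (Real.exp_le_exp.mpr (div_le_div_of_nonneg_right him (by positivity))) hpos

/-- ★★★ **END TO END, entry currency**: `‖Δ_{y₁}⋯Δ_{y_n} recordFluctRatioC (s)‖ ≤ e^{η + τ∕4}·e^{−κ₁ d}` (`d ≤ n`, `s ∈ cpoly(1+e^{κ₁})`) modulo EXACTLY: (F-coer) on `cpoly R'`;
(F-int) (measurable on `cpoly R'`, holomorphic along coordinate lines through `cpoly(1+e^{κ₁})` on `supp χ_rem`, `Re E ≤ η` there); (F-im) **`Σ_{ij}(Im piecesFormC(s)_{ij})² ≤ a²τ`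
on `cpoly(1+e^{κ₁})`** — no matrix inverse displayed.  [cite: Balaban1988RG2Cluster, (1.8)–(1.10) p.3–5, (1.18) p.7, (2.30) p.18 (shape; locators); Brydges1986, Part III §2 (locator)] -/
theorem norm_decDiffList_recordFluctRatioC_le_of_sum_sq_im {Ψ : Type*} (Mc k K : ℕ) (ε₁ : ℝ)
    (T : (recordDomSys F Mc k K).Dom → Ψ → FluctIdx F k K → FluctIdx F k K → ℂ) (E : ℝ → ((Fin 4 → ℤ) → ℂ) → Ψ → (NonB0Idx F k K → ℝ) → ℂ) (g : ℝ) (ψ : Ψ)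
    {κ₁ R' a : ℝ} (hκ0 : 0 ≤ κ₁) (hR' : 1 + Real.exp κ₁ < R') (ha : 0 < a) (η τ : ℝ)
    (hcoer : ∀ s ∈ cpoly (ι := Fin 4 → ℤ) R', ∀ x : NonB0Idx F k K → ℝ, a * ∑ i, x i ^ 2 ≤ (quadC (piecesFormC F k K T (recordSWeight F Mc k K s) ψ) x).re)
    (hEm : ∀ s ∈ cpoly (ι := Fin 4 → ℤ) R', Measurable (E g s ψ))
    (hEh : ∀ s ∈ cpoly (ι := Fin 4 → ℤ) (1 + Real.exp κ₁), ∀ (y : Fin 4 → ℤ) (x : NonB0Idx F k K → ℝ), chiRem F k K ε₁ x ≠ 0 →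
      DifferentiableOn ℂ (fun t : ℂ => E g (update s y t) ψ x) (ball (0 : ℂ) R'))
    (hEre : ∀ s ∈ cpoly (ι := Fin 4 → ℤ) R', ∀ x, chiRem F k K ε₁ x ≠ 0 → (E g s ψ x).re ≤ η)
    (him : ∀ s ∈ cpoly (ι := Fin 4 → ℤ) (1 + Real.exp κ₁), ∑ i, ∑ j, ((piecesFormC F k K T (recordSWeight F Mc k K s) ψ) i j).im ^ 2 ≤ a ^ 2 * τ)
    {l : List (Fin 4 → ℤ)} (hl : l.Nodup) {s : (Fin 4 → ℤ) → ℂ} (hs : s ∈ cpoly (ι := Fin 4 → ℤ) (1 + Real.exp κ₁)) {d : ℝ} (hd : d ≤ l.length) :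
    ‖decDiffList l (fun s => recordFluctRatioC F Mc k K ε₁ T E g s ψ) s‖ ≤ Real.exp (η + (1 / 4 : ℝ) * τ) * Real.exp (-κ₁ * d) := by
  classical
  have hR : (1 : ℝ) < 1 + Real.exp κ₁ := by linarith [Real.exp_pos κ₁]
  have hsub : cpoly (ι := Fin 4 → ℤ) (1 + Real.exp κ₁) ⊆ cpoly (ι := Fin 4 → ℤ) R' := cpoly_mono hR'.le
  exact norm_decDiffList_le_exp_of_le_length hR (by linarith) hκ0 (Real.exp_pos _).le
    (sepHolOff_recordFluctRatioC F Mc k K ε₁ T E g ψ hR' ha hcoer hEm hEh η hEre)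
    (bddOnPoly_recordFluctRatioC_of_sum_sq_im F Mc k K ε₁ T E g ψ ha η τ (fun s hs => hcoer s (hsub hs)) (fun s hs => hEre s (hsub hs)) him)
    hl hs hd

end Summit.QuantumFields.YangMills.Theorems.K0AxComplexGaussianRatio

end
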